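import Summits.Schanuel.Schanuel.Theorems.RootDecomp1KHyper74

/-!
# RootDecomp1KHyper — lens 6, generation 17 «BILOG STAIRCASE CELL» (BilogStair.lean edition 8 8bbe33c9…, 6010 l; §S `elimDataI_holds`, `transferI_holds`, `sb_three_zB` — the cell DECIDED) — continuation (RootDecomp1KHyper75): §S `ElimDataI` PROVED ⇒ TRANSFER I PROVED ⇒ `sb_three_zB : SB 3 zB` with NO hypothesis

(lens-6 g17 `BilogStair.lean` EDITION 8, sha256 8bbe33c9…b298, 6010 l, own farm rc 0 · 0 warn · 0 sorry · axioms std; §A–§R = editions 2–7 (ported as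
`RootDecomp1KHyper53`–`74`), §S appended in edition 8 (NODE/EDITION8 L1835 / REQUEST L1836 / RESULT L1837: statement diff 0 removed / 0 changed / 9 added; writer re-check L1841;
critic VERDICT L1844: CLEARED as EDITION 8 of record, the DEFERRED TransferI THEOREM credit PAID (`transferI_holds`), the CELL'S MATHEMATICS CLOSED — `sb_three_zB : SB 3 zB` with NO
hypothesis, the lineage's first hypothesis-free n = 3 decision on a bilog staircase tuple; K-R20 THIRD⁗ cell credit RESERVED to lens-6 pending the member package Q1/Q2; PORT GO);
port by census-1 gen 16 as `RootDecomp1KHyper75` — §S: `exists_prime_aeval_eq_zero`, `aeval_int_eq_zero`, `aeval_cons_eq_eval_map`, `eq_zero_of_forall_aeval_third`,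
`gI_eq_finSuccEquiv_rename`, `prime_gI`, `elimDataI_holds : ElimDataI` (prime factor of G₂ at the point via UFD ℤ[x₁,x₂,x₃]; Bezout = Mathlib `exists_mul_add_mul_eq_C_resultant`;
`Res_X ≠ 0` by Gauss's lemma over Frac(ℤ[x₁,T,u,v]) and evaluation on the fibre), `transferI_holds : TransferI`, `sb_three_zB : SB 3 zB` (= `sb_three_zB_of transferI_holds transferII_holds`).
PORT edits: `aeval_int_eq_zero` / `exists_prime_aeval_eq_zero` private (generic); statements and proofs verbatim. `--supports stmt-Schanuel-33363`; no census credit carried; rung 0 —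
nothing here proves HyperLiouvilleSchanuel in general.)
-/

open Complex Polynomial IntermediateField Filter
open scoped BigOperators

namespace Summit.Schanuel.Schanuel.Theorems.RootDecomp1KHyper

namespace HyperCell

namespace LatCell

namespace Bilog

variable {n : ℕ}
open Summit.Schanuel.Schanuel.Theorems.RootDecomp1KRelLiouvilleCell (mvPolyMeasure_one_of_polyMeasure ycoeff
  mvaeval_cons_eq_sum mvlen_ycoeff_le natDegree_finSuccEquiv_le_totalDegree norm_mvaeval_le_mvlen_mul_pow)

/-! ## §S  (EDITION 8) `ElimDataI` PROVED ⇒ TRANSFER I PROVED ⇒ the BILOG STAIRCASE CELL is DECIDED: `SB 3 zB`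

`ElimDataI` (pure commutative algebra of fixed polynomials): replace `G₂` by a PRIME factor `P₂` vanishing at the
point (UFD `ℤ[x₁,x₂,x₃]`); `g := gI P₂ ∈ B4[X]` is prime (transport along `rename` + `finSuccEquiv`), hence
irreducible and (in positive `X`-degree) primitive; the Bezout identity `f p + g q = C (Res_X(f,g))` is Mathlib's
`Polynomial.exists_mul_add_mul_eq_C_resultant`; and `Res_X(f, g) ≠ 0`, for otherwise `ḡ ∣ f̄` over
`K = Frac(B4)` (`resultant_eq_zero_iff`, irreducibility of `ḡ` by GAUSS'S LEMMA), so `g ∣ f` in `B4[X]` (Gauss again),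
and evaluating `f = g·h` at `(x₁, T, u, v; X) = (u, w, z/u, 0; v)` gives `G₁(u, v, z) = 0` for EVERY complex `z`,
whence `G₁ = 0` by the algebraic independence of `(u, v)` — contradiction.  (No degree-in-`T` count is needed.) -/

section ElimI

/-- A prime factor of `G ≠ 0` vanishing at a zero of `G`. -/
private theorem exists_prime_aeval_eq_zero {G : MvPolynomial (Fin 3) ℤ} (hG : G ≠ 0) {x : Fin 3 → ℂ}
    (h0 : MvPolynomial.aeval x G = 0) :
    ∃ P : MvPolynomial (Fin 3) ℤ, Prime P ∧ MvPolynomial.aeval x P = 0 := by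
  classical
  revert hG h0
  refine UniqueFactorizationMonoid.induction_on_prime G ?_ ?_ ?_
  · intro h; exact absurd rfl h
  · intro y hy _ h0
    exact absurd h0 (hy.map (MvPolynomial.aeval x)).ne_zero
  · intro a p ha hp ih _ h0
    rw [map_mul, mul_eq_zero] at h0
    rcases h0 with h0 | h0
    · exact ⟨p, hp, h0⟩
    · exact ih ha h0

/-- `ℚ`-algebraic independence gives injectivity of the INTEGER evaluation map. -/
private theorem aeval_int_eq_zero {n : ℕ} {θ : Fin n → ℂ} (hind : AlgebraicIndependent ℚ θ)
    {P : MvPolynomial (Fin n) ℤ} (hP : MvPolynomial.aeval θ P = 0) : P = 0 := by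
  have h1 : MvPolynomial.aeval θ (MvPolynomial.map (algebraMap ℤ ℚ) P) = 0 := by
    rw [MvPolynomial.aeval_map_algebraMap]; exact hP
  have h2 := algebraicIndependent_iff.1 hind _ h1
  exact MvPolynomial.map_injective (algebraMap ℤ ℚ) (algebraMap ℤ ℚ).injective_int
    (by rw [h2]; simp)

/-- `aeval (Fin.cons y θ) Q = ((finSuccEquiv Q).map (aeval θ)).eval y`. -/
theorem aeval_cons_eq_eval_map {n : ℕ} (Q : MvPolynomial (Fin (n + 1)) ℤ) (θ : Fin n → ℂ) (y : ℂ) :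
    MvPolynomial.aeval (Fin.cons y θ : Fin (n + 1) → ℂ) Q =
      ((MvPolynomial.finSuccEquiv ℤ n Q).map
        ((MvPolynomial.aeval θ : MvPolynomial (Fin n) ℤ →ₐ[ℤ] ℂ) : MvPolynomial (Fin n) ℤ →+* ℂ)).eval y := by
  rw [Polynomial.eval_map]
  set φ : MvPolynomial (Fin (n + 1)) ℤ →+* ℂ :=
    ((MvPolynomial.aeval (Fin.cons y θ : Fin (n + 1) → ℂ) :
      MvPolynomial (Fin (n + 1)) ℤ →ₐ[ℤ] ℂ) : MvPolynomial (Fin (n + 1)) ℤ →+* ℂ) with hφ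
  set ψ : MvPolynomial (Fin (n + 1)) ℤ →+* ℂ :=
    (Polynomial.eval₂RingHom ((MvPolynomial.aeval θ : MvPolynomial (Fin n) ℤ →ₐ[ℤ] ℂ) :
        MvPolynomial (Fin n) ℤ →+* ℂ) y).comp
      ((MvPolynomial.finSuccEquiv ℤ n : MvPolynomial (Fin (n + 1)) ℤ ≃ₐ[ℤ]
          Polynomial (MvPolynomial (Fin n) ℤ)) :
        MvPolynomial (Fin (n + 1)) ℤ →+* Polynomial (MvPolynomial (Fin n) ℤ)) with hψ
  have hφψ : φ = ψ := by
    refine MvPolynomial.ringHom_ext' (RingHom.ext_int _ _) fun i => ?_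
    refine Fin.cases ?_ (fun j => ?_) i
    · simp [φ, ψ, MvPolynomial.finSuccEquiv_X_zero]
    · simp [φ, ψ, MvPolynomial.finSuccEquiv_X_succ]
  have h1 := RingHom.congr_fun hφψ Q
  simpa [φ, ψ] using h1

/-- A polynomial vanishing on the whole fibre `{(u, v, z) : z ∈ ℂ}` over a `ℚ`-algebraically independent pair
`(u, v)` is zero. -/
theorem eq_zero_of_forall_aeval_third {G : MvPolynomial (Fin 3) ℤ} {u v : ℂ}
    (hind : AlgebraicIndependent ℚ ![u, v]) (h : ∀ z : ℂ, MvPolynomial.aeval ![u, v, z] G = 0) :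
    G = 0 := by
  -- reorder the variables so that the free one comes first
  have hkinj : Function.Injective (![1, 2, 0] : Fin 3 → Fin 3) := by decide
  have hPz : ∀ z : ℂ,
      MvPolynomial.aeval (Fin.cons z ![u, v] : Fin 3 → ℂ) (MvPolynomial.rename (![1, 2, 0] : Fin 3 → Fin 3) G)
        = 0 := by
    intro z
    rw [MvPolynomial.aeval_rename]
    have : ((Fin.cons z ![u, v] : Fin 3 → ℂ) ∘ (![1, 2, 0] : Fin 3 → Fin 3)) = ![u, v, z] := by
      funext i; fin_cases i <;> rfl
    rw [this]; exact h z
  -- the univariate polynomial `(finSuccEquiv P).map (aeval (u, v))` vanishes everywhere, hence is zero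
  have hχinj : Function.Injective
      ((MvPolynomial.aeval ![u, v] : MvPolynomial (Fin 2) ℤ →ₐ[ℤ] ℂ) : MvPolynomial (Fin 2) ℤ →+* ℂ) := by
    intro A B hAB
    have hAB' : MvPolynomial.aeval ![u, v] A = MvPolynomial.aeval ![u, v] B := by simpa using hAB
    exact sub_eq_zero.mp (aeval_int_eq_zero hind (P := A - B) (by rw [map_sub, hAB', sub_self]))
  have hmap : (MvPolynomial.finSuccEquiv ℤ 2 (MvPolynomial.rename (![1, 2, 0] : Fin 3 → Fin 3) G)).map
      ((MvPolynomial.aeval ![u, v] : MvPolynomial (Fin 2) ℤ →ₐ[ℤ] ℂ) : MvPolynomial (Fin 2) ℤ →+* ℂ) = 0 := by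
    refine Polynomial.funext fun z => ?_
    rw [← aeval_cons_eq_eval_map, Polynomial.eval_zero]
    exact hPz z
  have hP0 : MvPolynomial.finSuccEquiv ℤ 2 (MvPolynomial.rename (![1, 2, 0] : Fin 3 → Fin 3) G) = 0 :=
    Polynomial.map_injective _ hχinj (by rw [hmap, Polynomial.map_zero])
  have hP0' : MvPolynomial.rename (![1, 2, 0] : Fin 3 → Fin 3) G = 0 :=
    (MvPolynomial.finSuccEquiv ℤ 2).injective (by rw [hP0, map_zero])
  exact MvPolynomial.rename_injective _ hkinj (by rw [hP0', map_zero])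

/-- `gI` = rename into `ℤ[x₀,…,x₄]` followed by `finSuccEquiv` (variable `0 ↦ X`). -/
theorem gI_eq_finSuccEquiv_rename (G : MvPolynomial (Fin 3) ℤ) :
    gI G = MvPolynomial.finSuccEquiv ℤ 4
      (MvPolynomial.rename (![(0 : Fin 4).succ, 0, (1 : Fin 4).succ] : Fin 3 → Fin 5) G) := by
  have key : (MvPolynomial.aeval (![Polynomial.C (MvPolynomial.X 0), Polynomial.X,
        Polynomial.C (MvPolynomial.X 1)] : Fin 3 → Polynomial B4) : MvPolynomial (Fin 3) ℤ →ₐ[ℤ] Polynomial B4)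
      = ((MvPolynomial.finSuccEquiv ℤ 4 : MvPolynomial (Fin 5) ℤ ≃ₐ[ℤ] Polynomial (MvPolynomial (Fin 4) ℤ)) :
            MvPolynomial (Fin 5) ℤ →ₐ[ℤ] Polynomial (MvPolynomial (Fin 4) ℤ)).comp
          (MvPolynomial.rename (![(0 : Fin 4).succ, 0, (1 : Fin 4).succ] : Fin 3 → Fin 5)) := by
    refine MvPolynomial.algHom_ext fun i => ?_
    fin_cases i
    · simpa using (MvPolynomial.finSuccEquiv_X_succ (R := ℤ) (n := 4) (j := 0)).symm
    · simp [MvPolynomial.finSuccEquiv_X_zero]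
    · simpa using (MvPolynomial.finSuccEquiv_X_succ (R := ℤ) (n := 4) (j := 1)).symm
  exact AlgHom.congr_fun key G

/-- PRIMALITY TRANSPORT: `P` prime in `ℤ[x₁,x₂,x₃]` ⇒ `gI P` prime in `B4[X]`. -/
theorem prime_gI {P : MvPolynomial (Fin 3) ℤ} (hP : Prime P) : Prime (gI P) := by
  have heinj : Function.Injective (![(0 : Fin 4).succ, 0, (1 : Fin 4).succ] : Fin 3 → Fin 5) := by decide
  set s : Set (Fin 5) := Set.range (![(0 : Fin 4).succ, 0, (1 : Fin 4).succ] : Fin 3 → Fin 5) with hs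
  set ε : Fin 3 ≃ s := Equiv.ofInjective _ heinj with hε
  have h1 : MvPolynomial.rename (![(0 : Fin 4).succ, 0, (1 : Fin 4).succ] : Fin 3 → Fin 5) P =
      MvPolynomial.rename ((↑) : s → Fin 5) (MvPolynomial.rename ε P) := by
    rw [MvPolynomial.rename_rename]
    congr 1
  have h2 : Prime (MvPolynomial.rename ε P) := by
    have := (MulEquiv.prime_iff (MvPolynomial.renameEquiv ℤ ε)).mpr hP
    simpa only [MvPolynomial.renameEquiv_apply] using this
  have h3 : Prime (MvPolynomial.rename (![(0 : Fin 4).succ, 0, (1 : Fin 4).succ] : Fin 3 → Fin 5) P) := by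
    rw [h1]; exact (MvPolynomial.prime_rename_iff s).mpr h2
  rw [gI_eq_finSuccEquiv_rename]
  exact (MulEquiv.prime_iff (MvPolynomial.finSuccEquiv ℤ 4)).mpr h3

/-- **`ElimDataI` PROVED.** -/
theorem elimDataI_holds : ElimDataI := by
  intro G₁ G₂ hG₁ hG₂ u v w hind hG₂0
  obtain ⟨P₂, hP₂, hP₂0⟩ := exists_prime_aeval_eq_zero hG₂ hG₂0
  have hg : Prime (gI P₂) := prime_gI hP₂
  by_cases hdeg : (gI P₂).natDegree = 0
  · refine ⟨P₂, 0, 1, (gI P₂).coeff 0, hP₂0, ?_, ?_⟩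
    · intro hc
      apply hg.ne_zero
      rw [Polynomial.eq_C_of_natDegree_eq_zero hdeg, hc, map_zero]
    · rw [mul_zero, zero_add, mul_one]; exact Polynomial.eq_C_of_natDegree_eq_zero hdeg
  · obtain ⟨p, q, -, -, hpq⟩ :=
      Polynomial.exists_mul_add_mul_eq_C_resultant (fI G₁) (gI P₂) le_rfl le_rfl (Or.inr hdeg)
    refine ⟨P₂, p, q, _, hP₂0, ?_, hpq⟩
    intro hR
    -- GAUSS: `Res = 0` ⇒ `ḡ ∣ f̄` over `K = Frac(B4)` ⇒ `g ∣ f` in `B4[X]`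
    have girr : Irreducible (gI P₂) := hg.irreducible
    have gprim : (gI P₂).IsPrimitive := girr.isPrimitive hdeg
    let K := FractionRing B4
    have hφ : Function.Injective (algebraMap B4 K) := IsFractionRing.injective B4 K
    have hres : Polynomial.resultant ((fI G₁).map (algebraMap B4 K)) ((gI P₂).map (algebraMap B4 K)) = 0 := by
      rw [Polynomial.resultant_map_map, Polynomial.natDegree_map_eq_of_injective hφ,
        Polynomial.natDegree_map_eq_of_injective hφ, hR, map_zero]
    obtain ⟨-, hnc⟩ := Polynomial.resultant_eq_zero_iff.mp hres
    have girrK : Irreducible ((gI P₂).map (algebraMap B4 K)) :=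
      (gprim.irreducible_iff_irreducible_map_fraction_map (K := K)).mp girr
    have hdvdK : (gI P₂).map (algebraMap B4 K) ∣ (fI G₁).map (algebraMap B4 K) := by
      by_contra hnd
      exact hnc (girrK.coprime_iff_not_dvd.mpr hnd).symm
    have hdvd : gI P₂ ∣ fI G₁ := gprim.dvd_of_fraction_map_dvd_fraction_map hdvdK
    obtain ⟨h, hh⟩ := hdvd
    -- evaluate `f = g h` on the fibre `{(u, v, z)}`: `G₁(u, v, z) = P₂(u, v, w)·(…) = 0`
    have hu : u ≠ 0 := by
      intro hu
      have := algebraicIndependent_iff.1 hind (MvPolynomial.X 0) (by simp [hu])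
      exact MvPolynomial.X_ne_zero _ this
    have hfib : ∀ z : ℂ, MvPolynomial.aeval ![u, v, z] G₁ = 0 := by
      intro z
      have h1 := congrArg (fun P : Polynomial B4 => (P.map (evB u w (z / u) 0)).eval v) hh
      simp only [Polynomial.map_mul, Polynomial.eval_mul] at h1
      rw [fI_map_eval, gI_map_eval, hP₂0] at h1
      have hz : z / u * u + 0 * v = z := by rw [div_mul_cancel₀ z hu, zero_mul, add_zero]
      rw [hz, zero_mul] at h1
      exact h1
    exact hG₁ (eq_zero_of_forall_aeval_third hind hfib)

/-- **TRANSFER I PROVED.** -/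
theorem transferI_holds : TransferI := transferI_of_elimData elimDataI_holds

/-- **THE BILOG STAIRCASE CELL IS DECIDED: `SB 3 zB`** — `trdeg ℚ(π, ℓ_B, y_B, e^{i y_B}, …) ≥ 3` for the member
`z_B = (iπ, iℓ_B, iy_B)` (`ℓ_B = log((3+√17)/2)`, `y_B = Σ_j ⌊j!^{j!}(π + 2ℓ_B)⌋/(j!^{j!} 2^{j+1})`, a hyper-Liouville
point relative to `ℚπ + ℚℓ_B`), UNCONDITIONALLY and uniformly in the unknown `trdeg ℚ(π, ℓ_B)`. -/
theorem sb_three_zB : SB 3 zB := sb_three_zB_of transferI_holds transferII_holds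

end ElimI

end Bilog
end LatCell
end HyperCell
end Summit.Schanuel.Schanuel.Theorems.RootDecomp1KHyper
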